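import Summits.KontsevichZagierPeriods.KontsevichZagierPeriods.Theses.FermatIsogeny
import Summits.KontsevichZagierPeriods.KontsevichZagierPeriods.Theorems.FermatIsogenyBetaLinearSectorQuarters
import Summits.KontsevichZagierPeriods.KontsevichZagierPeriods.Theorems.FermatIsogenyBetaLinearSectorIntegerSums
import Summits.KontsevichZagierPeriods.KontsevichZagierPeriods.Theorems.FermatIsogenyBetaLinearSectorSixthsNormalForms

/-!
# `BetaLinearSector` on the UNION of the quarter-integer sector and the integer-sum sector, UNCONDITIONALLY

Crux `BetaLinearSector` (stmt-KontsevichZagierPeriods-3897, route FermatIsogeny): two one-dimensional Kontsevich–Zagier representations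
pinned on `(0,1)` as `[t^{a-1}(1-t)^{b-1}]` and `[c·t^{a'-1}(1-t)^{b'-1}]` (`a b a' b'` positive rationals, `c` real algebraic) with the same
value are KZ-equivalent.  Landed unconditional rungs: the quarter-integer sector `a, b, a', b' ∈ ¼ℤ` (`Quarters.betaLinearSector_quarters`,
Chudnovsky's `(π, Γ(1/4))`) and the integer-sum sector `a + b, a' + b' ∈ ℤ` at all levels (`IntegerSums.betaLinearSector_integerSums`, Euler's
reflection inside the rules + Lindemann).  THIS file proves the crux on the UNION of the two sectors with the CROSS PAIRS included
(registered anchor `betaLinearSector_quarters_or_integerSums`): each of the two pairs is EITHER quarter-integral OR has an integral sum —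
e.g. `[β(1/4,3/4)]` against `[c·β(2/7, 5/7)]`, or `[β(1/4,1/2)]` against `[c·β(3/5,7/5)]`.  After level reduction (which preserves the
disjunction) a base cell is either one of the sixteen quarter cells (normal form `Quarters.normalForm` onto the canonical cells
`T₀ = [β(1,1)]`, `T₁ = [β(1/2,1/2)]`, `T₂ = [√2·β(1/4,1/2)]`, `T₃ = [(4√2)⁻¹β(3/4,1/2)]`) or an Euler cell `(a, 1 − a)`, `0 < a < 1` of ANY
level, which normalises onto `(c / sin πa)·T₁` through `[π]` (`IntegerSums.nf_reflection` = `EulerReflectionRational` inside the rules, and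
`Sixths.T₁_equivalent_piRep`).  The class values `(1, π, Γ(1/4)²/√π, π√π/Γ(1/4)²)` are separated by Chudnovsky's theorem
(`Quarters.vq_sep`), so the assembly of the quarter file goes through verbatim on the larger set of base cells.

References: M. Kontsevich, D. Zagier, *Periods* (2001), §1.2; G. V. Chudnovsky (1984), Ch. 7 §2 Cor. 2.3; G. E. Andrews, R. Askey, R. Roy,
*Special Functions* (1999), Thm 1.2.1.
-/

noncomputable section

namespace Summit.KontsevichZagierPeriods.FermatIsogeny.BetaLinearSector.QuartersIntSum

open MeasureTheory Set
open Literature.NumberTheory.Transcendental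
open Literature.NumberTheory.Transcendental.KZ
open Summit.KontsevichZagierPeriods.FermatIsogeny.BetaLinearSector.HalfIntegers
open Summit.KontsevichZagierPeriods.FermatIsogeny.BetaLinearSector.Quarters (normalForm quarter_cases value_T0 value_T1 value_T2
  value_T3 vq_pos vq_sep)
open Summit.KontsevichZagierPeriods.FermatIsogeny.BetaLinearSector.IntegerSums (base_cases nf_reflection)
open Summit.KontsevichZagierPeriods.FermatIsogeny.BetaLinearSector.Sixths (T₁_equivalent_piRep)
open Summit.KontsevichZagierPeriods.KontsevichZagierPeriods.BetaCancellationLine (sin_pi_mul_pos)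
open Summit.KontsevichZagierPeriods.KontsevichZagierPeriods.BetaCancellationNegative (isAlgebraic_sin_pi_mul_rat)

set_option quotPrecheck false in
/-- `r` is PINNED as `[(0,1), c · t^{a-1}(1-t)^{b-1}]` (the two hypotheses on each representation in the crux, with a constant). -/
local notation "Pinned⟦" c ", " a ", " b ", " r "⟧" =>
  (IntegralRep.domain r = {x : Fin 1 → ℝ | x 0 ∈ Set.Ioo (0:ℝ) 1} ∧
    Set.EqOn (IntegralRep.integrand r) (fun x : Fin 1 → ℝ => (c : ℝ) * (x 0) ^ (((a : ℚ) : ℝ) - 1) * (1 - x 0) ^ (((b : ℚ) : ℝ) - 1))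
      (IntegralRep.domain r))

set_option quotPrecheck false in
/-- The two-sided, constant-carrying form of the crux for fixed exponents. -/
local notation "P⟦" a ", " b ", " a' ", " b' "⟧" =>
  (∀ (c c' : ℝ) (r r' : IntegralRep 1), IsAlgebraic ℚ c → IsAlgebraic ℚ c' →
    Pinned⟦c, a, b, r⟧ → Pinned⟦c', a', b', r'⟧ → IntegralRep.value r = IntegralRep.value r' → Equivalent r r')

set_option quotPrecheck false in
/-- The UNION SECTOR predicate on a pair of exponents: quarter-integral, or of integral sum. -/
local notation "Sec⟦" a ", " b "⟧" =>
  (((∃ m : ℤ, (a : ℚ) = m / 4) ∧ (∃ m : ℤ, (b : ℚ) = m / 4)) ∨ (∃ m : ℤ, (a : ℚ) + b = m))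

set_option quotPrecheck false in
/-- The four CLASS VALUES at level `4`: `(1, π, Γ(1/4)²/√π, π√π/Γ(1/4)²)`. -/
local notation "vq" => (![1, Real.pi, Real.Gamma (1/4) ^ 2 / Real.sqrt Real.pi, Real.pi * Real.sqrt Real.pi / Real.Gamma (1/4) ^ 2] :
  Fin 4 → ℝ)

/-! ## Part I — level reduction keeping the union sector -/

/-- The union-sector predicate survives lowering the second exponent by one. [folklore] -/
theorem sec_sub_right {a b : ℚ} (h : Sec⟦a, b⟧) : Sec⟦a, (b - 1)⟧ := by
  rcases h with ⟨hma, ⟨m, hm⟩⟩ | ⟨m, hm⟩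
  · exact Or.inl ⟨hma, ⟨m - 4, by rw [hm]; push_cast; ring⟩⟩
  · exact Or.inr ⟨m - 1, by push_cast; linarith⟩

/-- The union-sector predicate survives the swap followed by lowering. [folklore] -/
theorem sec_swap_sub {a b : ℚ} (h : Sec⟦a, b⟧) : Sec⟦b, (a - 1)⟧ := by
  rcases h with ⟨⟨m, hm⟩, hmb⟩ | ⟨m, hm⟩
  · exact Or.inl ⟨hmb, ⟨m - 4, by rw [hm]; push_cast; ring⟩⟩
  · exact Or.inr ⟨m - 1, by push_cast; linarith⟩

/-- LEVEL REDUCTION on the left pair, KEEPING THE UNION SECTOR: if `P⟦a₀, b₀, a', b'⟧` holds for all exponents `a₀, b₀ ∈ (0,1]` in the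
union sector, it holds for all positive rationals `a, b` in the union sector (strong induction on `⌊a⌋ + ⌊b⌋` with the landed chains
`P_lower_left`, `P_swap_left`). [folklore] -/
theorem P_of_base_left_sec {a' b' : ℚ}
    (base : ∀ a b : ℚ, 0 < a → a ≤ 1 → 0 < b → b ≤ 1 → Sec⟦a, b⟧ → P⟦a, b, a', b'⟧) :
    ∀ a b : ℚ, 0 < a → 0 < b → Sec⟦a, b⟧ → P⟦a, b, a', b'⟧ := by
  suffices H : ∀ n : ℕ, ∀ a b : ℚ, ⌊a⌋₊ + ⌊b⌋₊ = n → 0 < a → 0 < b → Sec⟦a, b⟧ → P⟦a, b, a', b'⟧ from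
    fun a b ha hb hm => H _ a b rfl ha hb hm
  intro n
  induction n using Nat.strong_induction_on with
  | _ n ih =>
    intro a b hn ha hb hm
    by_cases hb1 : b ≤ 1
    · by_cases ha1 : a ≤ 1
      · exact base a b ha ha1 hb hb1 hm
      · push Not at ha1
        have ha' : 0 < a - 1 := by linarith
        have hfl : ⌊a⌋₊ = ⌊a - 1⌋₊ + 1 := by
          conv_lhs => rw [← sub_add_cancel a 1]
          exact Nat.floor_add_one ha'.le
        have hlt : ⌊b⌋₊ + ⌊a - 1⌋₊ < n := by omega
        have hP : P⟦b, (a - 1), a', b'⟧ := ih _ hlt b (a - 1) rfl hb ha' (sec_swap_sub hm)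
        have hP' : P⟦b, a, a', b'⟧ := by simpa using P_lower_left hb ha' hP
        exact P_swap_left ha hb hP'
    · push Not at hb1
      have hb' : 0 < b - 1 := by linarith
      have hfl : ⌊b⌋₊ = ⌊b - 1⌋₊ + 1 := by
        conv_lhs => rw [← sub_add_cancel b 1]
        exact Nat.floor_add_one hb'.le
      have hlt : ⌊a⌋₊ + ⌊b - 1⌋₊ < n := by omega
      have hP : P⟦a, (b - 1), a', b'⟧ := ih _ hlt a (b - 1) rfl ha hb' (sec_sub_right hm)
      simpa using P_lower_left ha hb' hP

/-! ## Part II — base cells: quarter cells or Euler cells -/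

/-- The base cells of the union sector: a pair `a, b ∈ (0,1]` in the union sector is a QUARTER CELL (`a, b ∈ {1/4, 1/2, 3/4, 1}`) or an
EULER CELL `(a, 1 − a)`, `0 < a < 1` (of any level). [folklore] -/
theorem base_cases_sec {a b : ℚ} (ha : 0 < a) (ha1 : a ≤ 1) (hb : 0 < b) (hb1 : b ≤ 1) (h : Sec⟦a, b⟧) :
    ((a = 1 / 4 ∨ a = 1 / 2 ∨ a = 3 / 4 ∨ a = 1) ∧ (b = 1 / 4 ∨ b = 1 / 2 ∨ b = 3 / 4 ∨ b = 1)) ∨ (a < 1 ∧ b = 1 - a) := by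
  rcases h with ⟨hma, hmb⟩ | hm
  · exact Or.inl ⟨quarter_cases ha ha1 hma, quarter_cases hb hb1 hmb⟩
  · rcases base_cases ha ha1 hb hb1 hm with h | ⟨rfl, rfl⟩
    · exact Or.inr h
    · exact Or.inl ⟨by norm_num, by norm_num⟩

/-- NORMAL FORM OF THE BASE CELLS OF THE UNION SECTOR onto the four canonical cells of the quarter file, `T₀ = [β(1,1)]`,
`T₁ = [β(1/2,1/2)]`, `T₂ = [√2·β(1/4,1/2)]`, `T₃ = [(4√2)⁻¹·β(3/4,1/2)]`: quarter cells by `Quarters.normalForm`; an Euler cell `(a, 1−a)`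
(any rational `0 < a < 1`) is `(c / sin πa)·T₁` — Euler's reflection inside the rules (`IntegerSums.nf_reflection`) lands it on
`(c / sin πa)·[π]`, and `T₁ ∼ [π]` (`Sixths.T₁_equivalent_piRep`). [cite: KontsevichZagier2001, §1.2] -/
theorem normalForm_sec {c : ℝ} (hc : IsAlgebraic ℚ c) {a b : ℚ} (ha : 0 < a)
    (hcell : ((a = 1 / 4 ∨ a = 1 / 2 ∨ a = 3 / 4 ∨ a = 1) ∧ (b = 1 / 4 ∨ b = 1 / 2 ∨ b = 3 / 4 ∨ b = 1)) ∨ (a < 1 ∧ b = 1 - a))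
    {r : IntegralRep 1} (hr : Pinned⟦c, a, b, r⟧) (T : Fin 4 → IntegralRep 1)
    (hT0 : Pinned⟦(1 : ℝ), (1 : ℚ), (1 : ℚ), T 0⟧) (hT1 : Pinned⟦(1 : ℝ), (1/2 : ℚ), (1/2 : ℚ), T 1⟧)
    (hT2 : Pinned⟦(Real.sqrt 2), (1/4 : ℚ), (1/2 : ℚ), T 2⟧) (hT3 : Pinned⟦(4 * Real.sqrt 2)⁻¹, (3/4 : ℚ), (1/2 : ℚ), T 3⟧) :
    ∃ (i : Fin 4) (q : ℝ) (hk : IsAlgebraic ℚ (c * q)), 0 < q ^ 2 ∧ Equivalent r ((T i).constMul (c * q) hk) := by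
  rcases hcell with ⟨hqa, hqb⟩ | ⟨ha1, rfl⟩
  · exact normalForm hc hqa hqb hr T hT0 hT1 hT2 hT3
  · -- the Euler cell `(a, 1 − a)` onto `(c / sin πa)·T₁`
    have hs : IsAlgebraic ℚ (Real.sin (Real.pi * a)) := isAlgebraic_sin_pi_mul_rat ha
    have hs0 : Real.sin (Real.pi * a) ≠ 0 := (sin_pi_mul_pos ha ha1).ne'
    have hk : IsAlgebraic ℚ (c * (Real.sin (Real.pi * a))⁻¹) := hc.mul hs.inv
    obtain ⟨e, -⟩ := nf_reflection ha ha1 hr hk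
    have e₁ : Equivalent ((T 1).constMul (c * (Real.sin (Real.pi * a))⁻¹) hk)
        (piRep.constMul (c * (Real.sin (Real.pi * a))⁻¹) hk) :=
      (T₁_equivalent_piRep hT1).constMul _ hk
    exact ⟨1, (Real.sin (Real.pi * a))⁻¹, hk, by positivity, e.trans e₁.symm⟩

/-- **The base of the union sector**: `P⟦a, b, a', b'⟧` for base cells (quarter or Euler) on both sides — normal forms onto the same four
canonical cells, equal values force the same class (CHUDNOVSKY, `Quarters.vq_sep`) and then the same constant; degenerate constants
`c = 0` give two zero representations. [cite: KontsevichZagier2001, §1.2] [cite: Chudnovsky1984, Ch. 7 §2 Cor. 2.3] -/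
theorem P_base_sec {a b a' b' : ℚ} (ha : 0 < a) (hb : 0 < b) (ha' : 0 < a') (hb' : 0 < b')
    (hcell : ((a = 1 / 4 ∨ a = 1 / 2 ∨ a = 3 / 4 ∨ a = 1) ∧ (b = 1 / 4 ∨ b = 1 / 2 ∨ b = 3 / 4 ∨ b = 1)) ∨ (a < 1 ∧ b = 1 - a))
    (hcell' : ((a' = 1 / 4 ∨ a' = 1 / 2 ∨ a' = 3 / 4 ∨ a' = 1) ∧ (b' = 1 / 4 ∨ b' = 1 / 2 ∨ b' = 3 / 4 ∨ b' = 1)) ∨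
      (a' < 1 ∧ b' = 1 - a')) : P⟦a, b, a', b'⟧ := by
  intro c c' r r' hc hc' hr hr' hv
  have hvr := value_of_pinned hr ha hb
  have hvr' := value_of_pinned hr' ha' hb'
  have hBpos : ∀ {p q : ℚ}, 0 < p → 0 < q →
      0 < Real.Gamma (p:ℝ) * Real.Gamma (q:ℝ) / Real.Gamma ((p:ℝ) + (q:ℝ)) := fun {p q} hp hq => by
    have hpR : (0:ℝ) < p := by exact_mod_cast hp
    have hqR : (0:ℝ) < q := by exact_mod_cast hq
    exact div_pos (mul_pos (Real.Gamma_pos_of_pos hpR) (Real.Gamma_pos_of_pos hqR)) (Real.Gamma_pos_of_pos (by linarith))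
  -- the degenerate constants
  by_cases hc0 : c = 0
  · have hc'0 : c' = 0 := by
      have h0 : c' * (Real.Gamma (a':ℝ) * Real.Gamma (b':ℝ) / Real.Gamma ((a':ℝ) + (b':ℝ))) = 0 := by
        rw [← hvr', ← hv, hvr, hc0, zero_mul]
      exact (mul_eq_zero.1 h0).resolve_right (hBpos ha' hb').ne'
    have h1 : of r ∈ relations := of_mem_relations_of_eqOn_zero r fun x hx => by
      rw [hr.2 hx]
      simp [hc0]
    have h2 : of r' ∈ relations := of_mem_relations_of_eqOn_zero r' fun x hx => by
      rw [hr'.2 hx]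
      simp [hc'0]
    exact relations.sub_mem h1 h2
  have hc'0 : c' ≠ 0 := by
    intro h
    have h0 : c * (Real.Gamma (a:ℝ) * Real.Gamma (b:ℝ) / Real.Gamma ((a:ℝ) + (b:ℝ))) = 0 := by
      rw [← hvr, hv, hvr', h, zero_mul]
    exact hc0 ((mul_eq_zero.1 h0).resolve_right (hBpos ha hb).ne')
  -- the four canonical cells
  have hs2 : Real.sqrt 2 ^ 2 = 2 := Real.sq_sqrt (by norm_num)
  have h2 : IsAlgebraic ℚ (Real.sqrt 2) := by
    refine ⟨Polynomial.X ^ 2 - Polynomial.C 2, Polynomial.X_pow_sub_C_ne_zero (by norm_num) 2, ?_⟩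
    simp [hs2]
  have h4 : IsAlgebraic ℚ (4:ℝ) := by simpa using (isAlgebraic_rat ℚ 4 : IsAlgebraic ℚ (((4:ℚ)) : ℝ))
  have h42 : IsAlgebraic ℚ ((4 * Real.sqrt 2)⁻¹) := (h4.mul h2).inv
  obtain ⟨T0, hT0⟩ := exists_pinned (1 : ℝ) isAlgebraic_one (by norm_num : (0:ℚ) < 1) (by norm_num : (0:ℚ) < 1)
  obtain ⟨T1, hT1⟩ := exists_pinned (1 : ℝ) isAlgebraic_one (by norm_num : (0:ℚ) < 1/2) (by norm_num : (0:ℚ) < 1/2)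
  obtain ⟨T2, hT2⟩ := exists_pinned (Real.sqrt 2) h2 (by norm_num : (0:ℚ) < 1/4) (by norm_num : (0:ℚ) < 1/2)
  obtain ⟨T3, hT3⟩ := exists_pinned (4 * Real.sqrt 2)⁻¹ h42 (by norm_num : (0:ℚ) < 3/4) (by norm_num : (0:ℚ) < 1/2)
  have hTv : ∀ i : Fin 4, (![T0, T1, T2, T3] i).value = vq i := by
    intro i
    fin_cases i
    · exact value_T0 hT0
    · exact value_T1 hT1
    · exact value_T2 hT2
    · exact value_T3 hT3
  obtain ⟨i, q, hk, hq, e⟩ := normalForm_sec hc ha hcell hr ![T0, T1, T2, T3] hT0 hT1 hT2 hT3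
  obtain ⟨i', q', hk', hq', e'⟩ := normalForm_sec hc' ha' hcell' hr' ![T0, T1, T2, T3] hT0 hT1 hT2 hT3
  have hval : r.value = c * q * vq i := by rw [Equivalent.value_eq_holds e, IntegralRep.value_constMul, hTv]
  have hval' : r'.value = c' * q' * vq i' := by rw [Equivalent.value_eq_holds e', IntegralRep.value_constMul, hTv]
  have h := hv
  rw [hval, hval'] at h
  by_cases hii : i = i'
  · -- same class: the same multiple of the same canonical cell
    subst hii
    have hcq : c * q = c' * q' := mul_right_cancel₀ (vq_pos i).ne' h
    have emid : Equivalent ((![T0, T1, T2, T3] i).constMul (c * q) hk) ((![T0, T1, T2, T3] i).constMul (c' * q') hk') :=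
      of_sub_of_mem_relations_of_eqOn rfl fun x _ => by simp only [IntegralRep.integrand_constMul, hcq]
    exact e.trans (emid.trans e'.symm)
  · -- different classes: Chudnovsky
    exfalso
    have hq0 : q ≠ 0 := by rintro rfl; simp at hq
    have hcq0 : c * q ≠ 0 := mul_ne_zero hc0 hq0
    refine vq_sep i i' hii (c' * q' * (c * q)⁻¹) (hk'.mul hk.inv) ?_
    rw [← inv_mul_cancel_left₀ hcq0 (vq i), h]
    ring

/-- **`P⟦a, b, a', b'⟧` on the whole union sector**: reduce the right pair, then the left pair, to the base cells (`P_of_base_left_sec`)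
and apply `P_base_sec`. [folklore] -/
theorem P_all_sec {a b a' b' : ℚ} (ha : 0 < a) (hb : 0 < b) (ha' : 0 < a') (hb' : 0 < b') (hm : Sec⟦a, b⟧) (hm' : Sec⟦a', b'⟧) :
    P⟦a, b, a', b'⟧ := by
  refine P_of_base_left_sec (fun a₀ b₀ ha₀ ha₀1 hb₀ hb₀1 hm₀ => ?_) a b ha hb hm
  refine P_symm (P_of_base_left_sec (a' := a₀) (b' := b₀) (fun a₁ b₁ ha₁ ha₁1 hb₁ hb₁1 hm₁ => ?_) a' b' ha' hb' hm')
  exact P_base_sec ha₁ hb₁ ha₀ hb₀ (base_cases_sec ha₁ ha₁1 hb₁ hb₁1 hm₁) (base_cases_sec ha₀ ha₀1 hb₀ hb₀1 hm₀)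

/-- **`BetaLinearSector` ON THE UNION OF THE QUARTER-INTEGER AND THE INTEGER-SUM SECTORS, UNCONDITIONALLY** (registered anchor
`betaLinearSector_quarters_or_integerSums` of crux stmt-3897): Conjecture 1 of Kontsevich–Zagier for every pair of Beta integrals
`[∫₀¹ t^{a-1}(1-t)^{b-1}dt]`, `[∫₀¹ c·t^{a'-1}(1-t)^{b'-1}dt]` (positive rational exponents, `c` real algebraic, equal values) such that EACH
pair of exponents is quarter-integral OR has an integral sum — the cross pairs between the two landed sectors included.  Inputs: the
quarter file (normal forms, closed forms, Chudnovsky's `(π, Γ(1/4))`), Euler's reflection inside the rules (`EulerReflectionRational`)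
and `T₁ ∼ [π]`. [cite: KontsevichZagier2001, §1.2] [cite: Chudnovsky1984, Ch. 7 §2 Cor. 2.3] -/
theorem betaLinearSector_quarters_or_integerSums : ∀ (a b a' b' : ℚ) (c : ℝ), 0 < a → 0 < b → 0 < a' → 0 < b' → IsAlgebraic ℚ c →
    (((∃ m : ℤ, a = m / 4) ∧ (∃ m : ℤ, b = m / 4)) ∨ (∃ m : ℤ, a + b = m)) →
    (((∃ m : ℤ, a' = m / 4) ∧ (∃ m : ℤ, b' = m / 4)) ∨ (∃ m : ℤ, a' + b' = m)) →
    ∀ (r r' : KZ.IntegralRep 1), r.domain = {x | x 0 ∈ Set.Ioo (0:ℝ) 1} →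
    Set.EqOn r.integrand (fun x => (x 0) ^ ((a:ℝ) - 1) * (1 - x 0) ^ ((b:ℝ) - 1)) r.domain →
    r'.domain = {x | x 0 ∈ Set.Ioo (0:ℝ) 1} →
    Set.EqOn r'.integrand (fun x => c * (x 0) ^ ((a':ℝ) - 1) * (1 - x 0) ^ ((b':ℝ) - 1)) r'.domain →
    r.value = r'.value → KZ.Equivalent r r' := by
  intro a b a' b' c ha hb ha' hb' hc hm hm' r r' hd hi hd' hi' hv
  refine P_all_sec ha hb ha' hb' hm hm' 1 c r r' isAlgebraic_one hc ⟨hd, fun x hx => ?_⟩ ⟨hd', hi'⟩ hv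
  simp only [hi hx, one_mul]

end Summit.KontsevichZagierPeriods.FermatIsogeny.BetaLinearSector.QuartersIntSum

end
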